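import Mathlib
import Summits.Ventures.PercRepro2.Defs
import Summits.Ventures.PercRepro2.Graph

/-!
# Skeleton reduction with a moving third vertex — the definition (mine-a g6; MINE-A.md §38–§39)

`RB.ReducibleW ends s t b o w p`: the pair (third vertex `w`, weight vector `p`) reduces, by the
six exact reductions of row 2′RB — the three skeleton reductions of `RB.Reducible` (prune an
unmarked pendant vertex, merge a parallel pair, suppress an unmarked degree-2 vertex), ZEROING
every edge between `w` and `{s, t, b, o}` (§39: every such edge is removable), and moving from a
pendant third vertex to its neighbour (§38) — to a pair whose nonzero-weight edges at the third
vertex end in `{s, t, b, o}`. The typed row is a theorem on this class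
(`RB.RBcross_and_RBsame_of_reducibleW`, RBReducibleW.lean). Its complement is the residual
conjecture of the row: a third vertex with no marked neighbour and ≥ 2 unmarked skeleton
neighbours.
-/

namespace Summit.Ventures.PercRepro2

namespace RB

/-- `(w, p)` reduces, by the six exact reductions of row 2′RB, to «every nonzero-weight edge at the
third vertex ends in `{s, t, b, o}`». -/
inductive ReducibleW {V : Type*} {E : Type*} (ends : E → Sym2 V) (s t b o : V) {R : Type*}
    [Field R] [DecidableEq E] [DecidableEq V] : V → (E → R) → Prop
  /-- The kernel class: every nonzero-weight edge at `w` ends in `{s, t, b, o}`. -/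
  | kernel (w : V) (p : E → R)
      (H : ∀ e, w ∈ ends e → p e ≠ 0 →
        ends e = s(w, s) ∨ ends e = s(w, t) ∨ ends e = s(w, b) ∨ ends e = s(w, o)) :
      ReducibleW ends s t b o w p
  /-- Pruning an unmarked pendant vertex `u` (its single nonzero-weight edge `f = {u, v}`, `v ≠ u`). -/
  | prune (w : V) (p : E → R) (f : E) (u v : V) (hends : ends f = s(u, v)) (hvu : v ≠ u) (hus : u ≠ s)
      (hut : u ≠ t) (hub : u ≠ b) (huo : u ≠ o) (huw : u ≠ w)
      (huniq : ∀ e, u ∈ ends e → p e ≠ 0 → e = f)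
      (h : ReducibleW ends s t b o w (Function.update p f 0)) :
      ReducibleW ends s t b o w p
  /-- Merging a parallel pair `e ≠ e′` into `e` of weight `p e + p e′ − p e p e′`. -/
  | merge (w : V) (p : E → R) (e e' : E) (hne : e ≠ e') (hpar : ends e = ends e')
      (h : ReducibleW ends s t b o w
        (Function.update (Function.update p e (p e + p e' - p e * p e')) e' 0)) :
      ReducibleW ends s t b o w p
  /-- Suppressing an unmarked degree-2 vertex `u` (its nonzero-weight edges `f₁ = {u, v₁}`,
  `f₂ = {u, v₂}`) onto the edge `e₀ = {v₁, v₂}`, whose weight becomes `p e₀ + (1 − p e₀) p f₁ p f₂`. -/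
  | series (w : V) (p : E → R) (e₀ f₁ f₂ : E) (u v₁ v₂ : V) (hends₀ : ends e₀ = s(v₁, v₂))
      (hends₁ : ends f₁ = s(u, v₁)) (hends₂ : ends f₂ = s(u, v₂)) (hv₁ : v₁ ≠ u) (hv₂ : v₂ ≠ u)
      (h12 : f₁ ≠ f₂) (h01 : e₀ ≠ f₁) (h02 : e₀ ≠ f₂)
      (huniq : ∀ e, u ∈ ends e → p e ≠ 0 → e = f₁ ∨ e = f₂) (hus : u ≠ s) (hut : u ≠ t)
      (hub : u ≠ b) (huo : u ≠ o) (huw : u ≠ w)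
      (h : ReducibleW ends s t b o w (Function.update (Function.update (Function.update p e₀
        (p e₀ + (1 - p e₀) * (p f₁ * p f₂))) f₁ 0) f₂ 0)) :
      ReducibleW ends s t b o w p
  /-- Zeroing every edge between `w` and `{s, t, b, o}` (§39: root and marker edges are removable). -/
  | zeroMarked (w : V) (p : E → R)
      (h : ReducibleW ends s t b o w (fun e => if ends e = s(w, s) ∨ ends e = s(w, t) ∨
        ends e = s(w, b) ∨ ends e = s(w, o) then 0 else p e)) :
      ReducibleW ends s t b o w p
  /-- Moving from a pendant third vertex `w ∉ {s, t, b, o}` (single nonzero-weight edge `f = {w, u}`,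
  `u ≠ w`) to its neighbour `u` (§38). -/
  | pendantW (w u : V) (p : E → R) (f : E) (hends : ends f = s(w, u)) (huw : u ≠ w) (hws : w ≠ s)
      (hwt : w ≠ t) (hwb : w ≠ b) (hwo : w ≠ o) (huniq : ∀ e, w ∈ ends e → p e ≠ 0 → e = f)
      (h : ReducibleW ends s t b o u p) :
      ReducibleW ends s t b o w p

end RB

end Summit.Ventures.PercRepro2
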